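/-
Copyright (c) 2026 the pub-hodgecm-mathlib formalisation cell (harness21).  Prover seat hodgecm-mathlib-K2E4-p03 (g2), Track B «K2-LIT» ∕ h413
(`stmt-HodgeConjecture-24833`), line `K2_E3_EllipticInputs`, unit U3, line U3-d (lead K2E3-p03): FILE C rung C1 — the TRANSVECTION class, part (i).  2026-09-03.
-/
import Summits.HodgeConjecture.HodgeConjecture.Theorems.K2E3CayleyScalingMap          -- ★ p855474 (K2E3-p01): letters `hB`∕`hΨ`, `cayley`, ★ `inverseWindow_cayley` (via `K2E3CayleyScalingAlgebra`)
import Summits.HodgeConjecture.HodgeConjecture.Theorems.K2E3UnipotentAdaptedFrame      -- ★ p855528 (K2E3-p21 (g2)): SHARED FRAME of C1∕C2 — `mem_ball_of_isNilpotent`, §4 transport∕Haar glue; brings ★ `UnitaryThreeUnipotentConjugacy` (`exists_conj_coe_eq_cornerUnipotent_of_sq_eq_zero`), ★ `UnitaryThreeSingularUnipotentClasses` (`d(z)`, `coe_torusElt_conj_cornerUnipotent`)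
import HarnessLib

/-!
# K2_E3 road (h413 = stmt-HodgeConjecture-24833), U3-d FILE C, rung C1 «TRANSVECTION CLASS» — part (i): a conjugator `h` with `mat(h u₀ h⁻¹) = c((t·t)•X_{u₀}) = 1 + t²(u₀ − 1)`
# normalising `Z(u₀)`, for EVERY transvection `u₀` of the model `U(σ, J₀)(K)`

Cell `pub/hodgecm-mathlib` (D-0151), Track B; dealt BY NAME by the U3-d line lead K2E3-p03 (g0) (FILE C SPEC 2026-09-03T22:56Z; hands settled 22:59Z∕23:04Z;
FINAL MODEL-LEVEL TARGET 23:06Z), dealer K2E3-plan (g1) BATCH #3.  TARGET of FILE C per unipotent class: the hypotheses (i′) «`∃ h : M`, `mat(h u₀ h⁻¹) = cayley((t·t) • X)`,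
`X := (mat u₀ − 1)(mat u₀ + 1)⁻¹`, and `∀ z, z ∈ Z(u₀) ↔ h z h⁻¹ ∈ Z(u₀)`» and (ii) «compact open `K`, Haar `ρ`, index identity `hr`» of ★ p855453 §1
`K2E3UnipotentOrbitalScalingOfIndex.integral_descConj_indicator_comp_eq_smul_of_conj_of_index`, in the MODEL letters of ★ `K2E3CayleyScalingModel` ∕ ★
`K2E3CayleyScalingMap` (K2E3-p01).  THIS FILE = part (i′) for the TRANSVECTION class (`(mat u₀ − 1)² = 0`), twin of ★ `K2E3UnipotentOrbitalScalingRegular` (K2E1b-p01 (g3), the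
regular class); it imports the SHARED FRAME ★ `K2E3UnipotentAdaptedFrame` (K2E3-p21 (g2): corner∕torus letters, `mem_ball_of_isNilpotent`, the §4 transport and Haar glue)
and restates none of it — the new content here is BASIS-FREE (§1: no corner form is needed to read `X_{u₀}` and `c(s•X_{u₀})` of a transvection) and the PACKAGED
Ψ-free existence (i′) in the line lead's final letters; part (ii) (the ONE count `[Z ∩ K : Z ∩ hKh⁻¹] = Q²`, `Q = (Nat.card 𝓀[K])^k`, fed to the frame's
`coe_mul_measure_preimage_eq_of_relIndex_eq`) is the sequel `K2E3UnipotentOrbitalScalingTransvectionIndex`.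

* §1 (any field, `2 ≠ 0`; any size) **the Cayley window of a square-zero element is linear**: for `Y² = 0`, `c(Y) = 1 + 2Y` (`cayley_of_mul_self_eq_zero`); for `(g − 1)² = 0`,
  `X_g := (g − 1)(g + 1)⁻¹ = ½(g − 1)` (`inverseWindow_of_sub_one_mul_self_eq_zero`, via `g = c(½(g − 1))` and ★ `inverseWindow_cayley`) and
  **`c(s • X_g) = 1 + s•(g − 1)`** (`cayley_smul_inverseWindow_of_sub_one_mul_self_eq_zero`) — the Cayley scaling `Ψ_s` DILATES the nilpotent part of a transvection by `s`.
* §2 (any field, `σ` an involution, `J₀ = (StdForm.antidiagonal 3).over K`) **(i′) FOR THE TRANSVECTION CLASS** (`exists_mem_coe_conj_eq_one_add_smul`): for `u ∈ U(σ, J₀)` with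
  `(u − 1)² = 0` and `t ∈ K^×` with `σ t = t`, there is `h ∈ U(σ, J₀)` with `h u h⁻¹ = 1 + (t·t)•(u − 1)`: [Rogawski1990, §3.9] conjugates `u` to the corner transvection
  `n(τ) = 1 + τE₀₂` (★ `exists_conj_coe_eq_cornerUnipotent_of_sq_eq_zero`), the torus element `d(t) = diag(t, 1, (σt)⁻¹) ∈ U(σ, J₀)` (★ `torusElt_mem_unitaryGroupOfForm`) gives
  `d(t) n(τ) d(t)⁻¹ = n(t·σt·τ) = n(t²τ)` (★ `coe_torusElt_conj_cornerUnipotent`), and `h := k⁻¹ d(t) k`.  NORMALISATION (`mem_centralizer_iff_conj_mem_centralizer_of_coe_conj`):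
  `Z(1 + s(u − 1)) = Z(u)` for `s ≠ 0` (commuting with `u` is commuting with `u − 1`), so `z ∈ Z(u₀) ↔ h z h⁻¹ ∈ Z(u₀)`.  HEADS: `exists_conj_normalizing_of_sq_eq_zero` (Ψ-free
  (i′), the line lead's letters: `mat(h u₀ h⁻¹) = cayley((t·t) • X_{u₀})` + `hZ`) and, in K2E3-p01's letters `hB`∕`hΨ` with `s = t·t`, `exists_conj_normalizing_of_transvection`
  (`Ψ u₀ = h u₀ h⁻¹` + `hZ` — the letters `hΨ`, `hZ` of ★ p855453 §1 verbatim; NO `u₀ ∈ B` hypothesis: every unipotent lies in `B`, ★ frame `mem_ball_of_isNilpotent`).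

THEOREMS ONLY (no definition ∕ instance ∕ notation ∕ named fact ∕ `sorry`); imports ★ + HarnessLib; lane `--supports stmt-HodgeConjecture-24833 --as helper`.
HONEST LABEL: HC_CM is proved only modulo the 7 printed citations (2 remaining named inputs: hLiu418 = stmt-HodgeConjecture-24832, h413 =
stmt-HodgeConjecture-24833) until rung 0 closes; count-neutral helper of the U3-d line.

## References
* [Rogawski1990] J. D. Rogawski, *Automorphic Representations of Unitary Groups in Three Variables*, Ann. of Math. Stud. 123 (1990), §3.9 p. 32 (singular unipotent
  classes `n(t)`, `t mod NE^×`); §8.1 Prop. 8.1.2 (b) p. 114 (homogeneity `Γ_u(exp(t²Y)) = |t|^{−d(u)}Γ_u(exp Y)`).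
* [HarishChandra1999AdmissibleDistributions] Harish-Chandra, *Admissible Invariant Distributions on Reductive p-adic Groups*, ULS 16 (1999), §3.1 Lemma 3.2.
* [PlatonovRapinchuk1994] V. Platonov, A. Rapinchuk, *Algebraic Groups and Number Theory* (1994), §3.3 (Cayley parametrisation).
-/

set_option autoImplicit false
-- the mandated namespace repeats the single-problem summit's segment (`HodgeConjecture.HodgeConjecture`), as in every `Theorems/*.lean` of this sub-problem
set_option linter.dupNamespace false

noncomputable section

open Matrix
open scoped Matrix MatrixGroups
open Literature.NumberTheory.Automorphic Literature.NumberTheory.Automorphic.UnitaryGroup Literature.NumberTheory.Automorphic.HermitianLattice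
open Literature.NumberTheory.Weil1982.UnitaryFinTopForm Literature.LinearAlgebra.Matrix
open Summit.HodgeConjecture.HodgeConjecture.Cruxes.H413.K2E3CayleyScalingAlgebra
open Summit.HodgeConjecture.HodgeConjecture.Cruxes.H413.K2E3CayleyScalingModel
open Summit.HodgeConjecture.HodgeConjecture.Cruxes.H413.K2E3CayleyScalingMap

namespace Summit.HodgeConjecture.HodgeConjecture.Cruxes.H413.K2E3UnipotentOrbitalScalingTransvection

/-! ## §1 The Cayley window of a square-zero element -/

section Field

variable {K : Type*} [Field K] {n : Type*} [Fintype n] [DecidableEq n]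

/-- `(1 − Y)(1 + Y) = 1` for `Y² = 0`, so `(1 − Y)⁻¹ = 1 + Y` and `det(1 − Y)` is a unit. [cite: PlatonovRapinchuk1994, §3.3] -/
theorem one_sub_mul_one_add_eq_one_of_mul_self_eq_zero {Y : Matrix n n K} (hY : Y * Y = 0) : (1 - Y) * (1 + Y) = 1 := by
  rw [Matrix.sub_mul, Matrix.mul_add, Matrix.mul_add, Matrix.one_mul, Matrix.one_mul, Matrix.mul_one, hY, add_zero, add_sub_cancel_right]

/-- `det(1 − Y)` is a unit for `Y² = 0`. [cite: PlatonovRapinchuk1994, §3.3] -/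
theorem isUnit_det_one_sub_of_mul_self_eq_zero {Y : Matrix n n K} (hY : Y * Y = 0) : IsUnit (1 - Y).det :=
  Matrix.isUnit_det_of_right_inverse (one_sub_mul_one_add_eq_one_of_mul_self_eq_zero hY)

/-- **`c(Y) = 1 + 2Y` for `Y² = 0`**: `c(Y) = (1 + Y)(1 − Y)⁻¹ = (1 + Y)(1 + Y) = 1 + Y + Y`. [cite: PlatonovRapinchuk1994, §3.3] -/
theorem cayley_of_mul_self_eq_zero {Y : Matrix n n K} (hY : Y * Y = 0) : cayley Y = 1 + (Y + Y) := by
  rw [cayley_def, Matrix.inv_eq_right_inv (one_sub_mul_one_add_eq_one_of_mul_self_eq_zero hY), Matrix.add_mul, Matrix.one_mul, Matrix.mul_add, Matrix.mul_one, hY,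
    add_zero, add_assoc]

omit [DecidableEq n] in
/-- Square-zero is stable under scalars: `(a • Y)² = 0`. [folklore] -/
theorem smul_mul_smul_self_eq_zero {Y : Matrix n n K} (hY : Y * Y = 0) (a : K) : (a • Y) * (a • Y) = 0 := by
  rw [Matrix.smul_mul, Matrix.mul_smul, hY, smul_zero, smul_zero]

/-- **A transvection is the Cayley transform of half its nilpotent part**: `g = c(½(g − 1))` when `(g − 1)² = 0` (`2 ≠ 0`). [cite: PlatonovRapinchuk1994, §3.3] -/
theorem cayley_half_smul_sub_one_of_mul_self_eq_zero (h2 : (2 : K) ≠ 0) {g : Matrix n n K} (hsq : (g - 1) * (g - 1) = 0) :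
    cayley ((2 : K)⁻¹ • (g - 1)) = g := by
  rw [cayley_of_mul_self_eq_zero (smul_mul_smul_self_eq_zero hsq _), ← add_smul, ← two_mul, mul_inv_cancel₀ h2, one_smul, add_sub_cancel]

/-- **`X_g = ½(g − 1)`** for `(g − 1)² = 0` (`2 ≠ 0`): `(g − 1)(g + 1)⁻¹ = ½(g − 1)` (read `g = c(½(g − 1))` through ★ `inverseWindow_cayley`). [cite: PlatonovRapinchuk1994, §3.3] -/
theorem inverseWindow_of_sub_one_mul_self_eq_zero (h2 : (2 : K) ≠ 0) {g : Matrix n n K} (hsq : (g - 1) * (g - 1) = 0) :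
    (g - 1) * (g + 1)⁻¹ = (2 : K)⁻¹ • (g - 1) := by
  conv_lhs => rw [← cayley_half_smul_sub_one_of_mul_self_eq_zero h2 hsq]
  exact inverseWindow_cayley (isUnit_iff_ne_zero.2 h2) (isUnit_det_one_sub_of_mul_self_eq_zero (smul_mul_smul_self_eq_zero hsq _))

/-- `det(g + 1)` is a unit for a transvection (`2 ≠ 0`): `g + 1 = c(½(g − 1)) + 1` (★ `isUnit_det_cayley_add_one`). [cite: PlatonovRapinchuk1994, §3.3] -/
theorem isUnit_det_add_one_of_sub_one_mul_self_eq_zero (h2 : (2 : K) ≠ 0) {g : Matrix n n K} (hsq : (g - 1) * (g - 1) = 0) : IsUnit (g + 1).det := by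
  rw [← cayley_half_smul_sub_one_of_mul_self_eq_zero h2 hsq]
  exact isUnit_det_cayley_add_one (isUnit_iff_ne_zero.2 h2) (isUnit_det_one_sub_of_mul_self_eq_zero (smul_mul_smul_self_eq_zero hsq _))

/-- **THE CAYLEY SCALING DILATES THE NILPOTENT PART OF A TRANSVECTION**: `c(s • X_g) = 1 + s•(g − 1)` for `(g − 1)² = 0` (`2 ≠ 0`).
[cite: HarishChandra1999AdmissibleDistributions, §3.1 Lemma 3.2] [cite: PlatonovRapinchuk1994, §3.3] -/
theorem cayley_smul_inverseWindow_of_sub_one_mul_self_eq_zero (h2 : (2 : K) ≠ 0) (s : K) {g : Matrix n n K} (hsq : (g - 1) * (g - 1) = 0) :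
    cayley (s • ((g - 1) * (g + 1)⁻¹)) = 1 + s • (g - 1) := by
  rw [inverseWindow_of_sub_one_mul_self_eq_zero h2 hsq, smul_smul, cayley_of_mul_self_eq_zero (smul_mul_smul_self_eq_zero hsq _), ← add_smul, ← two_mul,
    ← mul_assoc, mul_comm (2 : K) s, mul_assoc, mul_inv_cancel₀ h2, mul_one]

/-- Commuting with `g` is commuting with `1 + s•(g − 1)` (`s ≠ 0`): the centraliser of a transvection is that of its dilates. [cite: Rogawski1990, §3.9 p. 32] -/
theorem commute_one_add_smul_sub_one_iff {s : K} (hs : s ≠ 0) (g z : Matrix n n K) :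
    z * (1 + s • (g - 1)) = (1 + s • (g - 1)) * z ↔ z * g = g * z := by
  rw [Matrix.mul_add, Matrix.add_mul, Matrix.mul_one, Matrix.one_mul, add_right_inj, Matrix.mul_smul, Matrix.smul_mul, Matrix.mul_sub, Matrix.sub_mul,
    Matrix.mul_one, Matrix.one_mul]
  constructor
  · intro h
    have h' := congrArg (fun M => s⁻¹ • M) h
    simp only [smul_smul, inv_mul_cancel₀ hs, one_smul] at h'
    exact sub_left_injective h'
  · intro h; rw [h]

/-- Conjugation is linear: `x (1 + s•(A − 1)) x⁻¹ = 1 + s•(x A x⁻¹ − 1)`. [folklore] -/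
theorem conj_one_add_smul_sub_one (x : GL n K) (s : K) (A : Matrix n n K) :
    (x : Matrix n n K) * (1 + s • (A - 1)) * ((x⁻¹ : GL n K) : Matrix n n K) = 1 + s • ((x : Matrix n n K) * A * ((x⁻¹ : GL n K) : Matrix n n K) - 1) := by
  have hx : (x : Matrix n n K) * ((x⁻¹ : GL n K) : Matrix n n K) = 1 := by rw [← Units.val_mul, mul_inv_cancel, Units.val_one]
  rw [Matrix.mul_add, Matrix.add_mul, Matrix.mul_one, hx, Matrix.mul_smul, Matrix.smul_mul, Matrix.mul_sub, Matrix.sub_mul, Matrix.mul_one, hx]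

end Field

/-! ## §2 (i′) for the transvection class of `U(σ, J₀)(K)` -/

section Unitary

variable {K : Type*} [Field K] (σ : K →+* K)

/-- `1 + s•(n(τ) − 1) = n(sτ)` for the corner transvection `n(τ) = 1 + τE₀₂`. [cite: Rogawski1990, §1.10 p. 9] -/
theorem one_add_smul_cornerUnipotent_sub_one (s τ : K) :
    (1 : Matrix (Fin 3) (Fin 3) K) + s • ((!![1, 0, τ; 0, 1, 0; 0, 0, 1] : Matrix (Fin 3) (Fin 3) K) - 1) = !![1, 0, s * τ; 0, 1, 0; 0, 0, 1] := by
  ext i j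
  fin_cases i <;> fin_cases j <;> simp

/-- **(i′) AT THE `GL₃` LEVEL**: for `u ∈ U(σ, J₀)` with `(u − 1)² = 0` and `t ≠ 0` with `σ t = t` (`σ` an involution) there is `h ∈ U(σ, J₀)` with
`h u h⁻¹ = 1 + (t·t)•(u − 1)`: `k u k⁻¹ = n(τ)` ([Rogawski1990, §3.9], ★ `exists_conj_coe_eq_cornerUnipotent_of_sq_eq_zero`), `d(t) n(τ) d(t)⁻¹ = n(t σt τ) = n(t²τ)`
(★ `coe_torusElt_conj_cornerUnipotent`, `d(t) ∈ U` by ★ `torusElt_mem_unitaryGroupOfForm`), `h := k⁻¹ d(t) k`. [cite: Rogawski1990, §3.9 p. 32]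
[cite: HarishChandra1999AdmissibleDistributions, §3.1 Lemma 3.2] -/
theorem exists_mem_coe_conj_eq_one_add_smul (hσ : ∀ z : K, σ (σ z) = z) {t : K} (ht : t ≠ 0) (hσt : σ t = t) {u : GL (Fin 3) K}
    (hu : u ∈ unitaryGroupOfForm σ ((StdForm.antidiagonal 3).over K)) (hsq : ((u : Matrix (Fin 3) (Fin 3) K) - 1) * ((u : Matrix (Fin 3) (Fin 3) K) - 1) = 0) :
    ∃ h : GL (Fin 3) K, h ∈ unitaryGroupOfForm σ ((StdForm.antidiagonal 3).over K) ∧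
      ((h * u * h⁻¹ : GL (Fin 3) K) : Matrix (Fin 3) (Fin 3) K) = 1 + (t * t) • ((u : Matrix (Fin 3) (Fin 3) K) - 1) := by
  obtain ⟨k, hk, τ, -, hku⟩ := exists_conj_coe_eq_cornerUnipotent_of_sq_eq_zero σ hσ hu hsq
  obtain ⟨d, hd, hd'⟩ := exists_units_coe_eq_torusElt σ ht
  have hdU : d ∈ unitaryGroupOfForm σ ((StdForm.antidiagonal 3).over K) := torusElt_mem_unitaryGroupOfForm σ ht (by rw [hσt, hσt]) hd
  refine ⟨k⁻¹ * d * k, mul_mem (mul_mem (inv_mem hk) hdU) hk, ?_⟩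
  -- `h u h⁻¹ = k⁻¹ (d (k u k⁻¹) d⁻¹) k`
  have hgrp : k⁻¹ * d * k * u * (k⁻¹ * d * k)⁻¹ = k⁻¹ * (d * (k * u * k⁻¹) * d⁻¹) * k := by group
  have hdn : ((d * (k * u * k⁻¹) * d⁻¹ : GL (Fin 3) K) : Matrix (Fin 3) (Fin 3) K) = !![1, 0, t * t * τ; 0, 1, 0; 0, 0, 1] := by
    rw [coe_torusElt_conj_cornerUnipotent σ ht hd hd' hku, hσt]
  -- `u = k⁻¹ n(τ) k`
  have hkk : ((k⁻¹ : GL (Fin 3) K) : Matrix (Fin 3) (Fin 3) K) * (k : Matrix (Fin 3) (Fin 3) K) = 1 := by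
    rw [← Units.val_mul, inv_mul_cancel, Units.val_one]
  have hu' : (u : Matrix (Fin 3) (Fin 3) K) = ((k⁻¹ : GL (Fin 3) K) : Matrix (Fin 3) (Fin 3) K) * !![1, 0, τ; 0, 1, 0; 0, 0, 1] * (((k⁻¹)⁻¹ : GL (Fin 3) K) : Matrix (Fin 3) (Fin 3) K) := by
    rw [inv_inv, ← hku, Units.val_mul, Units.val_mul]
    simp only [← Matrix.mul_assoc, hkk, Matrix.one_mul]
    rw [Matrix.mul_assoc, hkk, Matrix.mul_one]
  rw [hgrp, Units.val_mul, Units.val_mul, hdn, hu', ← conj_one_add_smul_sub_one k⁻¹ (t * t), one_add_smul_cornerUnipotent_sub_one, inv_inv]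

/-- **NORMALISATION**: if `mat(h u₀ h⁻¹) = 1 + s•(mat u₀ − 1)` with `s ≠ 0` then `z ∈ Z(u₀) ↔ h z h⁻¹ ∈ Z(u₀)` for every `z ∈ U(σ, J)` — the letter `hZ` of ★ p855453 §1
(`Z(1 + s(u₀ − 1)) = Z(u₀)` and conjugation). [cite: Rogawski1990, §3.9 p. 32] [cite: HarishChandra1999AdmissibleDistributions, §3.1 Lemma 3.2] -/
theorem mem_centralizer_iff_conj_mem_centralizer_of_coe_conj {J : Matrix (Fin 3) (Fin 3) K} {s : K} (hs : s ≠ 0) {u₀ h : ↥(unitaryGroupOfForm σ J)}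
    (hconj : (((h * u₀ * h⁻¹ : ↥(unitaryGroupOfForm σ J)) : GL (Fin 3) K) : Matrix (Fin 3) (Fin 3) K) = 1 + s • (((u₀ : GL (Fin 3) K) : Matrix (Fin 3) (Fin 3) K) - 1))
    (z : ↥(unitaryGroupOfForm σ J)) :
    z ∈ Subgroup.centralizer ({u₀} : Set ↥(unitaryGroupOfForm σ J)) ↔ h * z * h⁻¹ ∈ Subgroup.centralizer ({u₀} : Set ↥(unitaryGroupOfForm σ J)) := by
  -- matrices of subgroup elements
  have hcoe : ∀ x y : ↥(unitaryGroupOfForm σ J), x * y = y * x ↔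
      ((x : GL (Fin 3) K) : Matrix (Fin 3) (Fin 3) K) * ((y : GL (Fin 3) K) : Matrix (Fin 3) (Fin 3) K) =
        ((y : GL (Fin 3) K) : Matrix (Fin 3) (Fin 3) K) * ((x : GL (Fin 3) K) : Matrix (Fin 3) (Fin 3) K) := fun x y => by
    constructor
    · intro hxy
      have := congrArg (fun w : ↥(unitaryGroupOfForm σ J) => ((w : GL (Fin 3) K) : Matrix (Fin 3) (Fin 3) K)) hxy
      simpa only [Subgroup.coe_mul, Units.val_mul] using this
    · intro hxy
      exact Subtype.ext (Units.ext (by simpa only [Subgroup.coe_mul, Units.val_mul] using hxy))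
  rw [Subgroup.mem_centralizer_singleton_iff, Subgroup.mem_centralizer_singleton_iff]
  -- `h z h⁻¹` commutes with `u₀` iff it commutes with `h u₀ h⁻¹ = 1 + s(u₀ − 1)` iff `z` commutes with `u₀`
  have key : h * z * h⁻¹ * u₀ = u₀ * (h * z * h⁻¹) ↔ h * z * h⁻¹ * (h * u₀ * h⁻¹) = h * u₀ * h⁻¹ * (h * z * h⁻¹) := by
    rw [hcoe, hcoe, hconj, commute_one_add_smul_sub_one_iff hs]
  rw [key]
  constructor
  · intro hzu
    calc h * z * h⁻¹ * (h * u₀ * h⁻¹) = h * (z * u₀) * h⁻¹ := by group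
      _ = h * (u₀ * z) * h⁻¹ := by rw [hzu]
      _ = h * u₀ * h⁻¹ * (h * z * h⁻¹) := by group
  · intro H
    calc z * u₀ = h⁻¹ * (h * z * h⁻¹ * (h * u₀ * h⁻¹)) * h := by group
      _ = h⁻¹ * (h * u₀ * h⁻¹ * (h * z * h⁻¹)) * h := by rw [H]
      _ = u₀ * z := by group

/-- **(i′) FOR THE TRANSVECTION CLASS, Ψ-FREE** (the U3-d line lead's letters, 2026-09-03T23:06Z): on the antidiagonal model `U(σ, J₀)(K)` (`σ` an involution, `2 ≠ 0`),
for every `t ≠ 0` with `σ t = t` and every `u₀` with `(mat u₀ − 1)² = 0` there is `h` with `mat(h u₀ h⁻¹) = c((t·t) • X_{u₀})`, `X_{u₀} = (mat u₀ − 1)(mat u₀ + 1)⁻¹`, and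
`∀ z, z ∈ Z(u₀) ↔ h z h⁻¹ ∈ Z(u₀)` (§1: `c((t·t)•X_{u₀}) = 1 + t²(mat u₀ − 1)`; §2). [cite: Rogawski1990, §3.9 p. 32; §8.1 Prop. 8.1.2 (b) p. 114]
[cite: HarishChandra1999AdmissibleDistributions, §3.1 Lemma 3.2] -/
theorem exists_conj_normalizing_of_sq_eq_zero {J : Matrix (Fin 3) (Fin 3) K} (hJ : J = (StdForm.antidiagonal 3).over K) (hσ : ∀ z : K, σ (σ z) = z)
    (h2 : (2 : K) ≠ 0) {t : K} (ht : t ≠ 0) (hσt : σ t = t) {u₀ : ↥(unitaryGroupOfForm σ J)}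
    (hsq : (((u₀ : GL (Fin 3) K) : Matrix (Fin 3) (Fin 3) K) - 1) * (((u₀ : GL (Fin 3) K) : Matrix (Fin 3) (Fin 3) K) - 1) = 0) :
    ∃ h : ↥(unitaryGroupOfForm σ J),
      (((h * u₀ * h⁻¹ : ↥(unitaryGroupOfForm σ J)) : GL (Fin 3) K) : Matrix (Fin 3) (Fin 3) K) =
          cayley ((t * t) • ((((u₀ : GL (Fin 3) K) : Matrix (Fin 3) (Fin 3) K) - 1) * (((u₀ : GL (Fin 3) K) : Matrix (Fin 3) (Fin 3) K) + 1)⁻¹)) ∧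
      ∀ z : ↥(unitaryGroupOfForm σ J), z ∈ Subgroup.centralizer ({u₀} : Set ↥(unitaryGroupOfForm σ J)) ↔
        h * z * h⁻¹ ∈ Subgroup.centralizer ({u₀} : Set ↥(unitaryGroupOfForm σ J)) := by
  subst hJ
  obtain ⟨h, hh, hconj⟩ := exists_mem_coe_conj_eq_one_add_smul σ hσ ht hσt u₀.2 hsq
  have hconj' : ((((⟨h, hh⟩ : ↥(unitaryGroupOfForm σ ((StdForm.antidiagonal 3).over K))) * u₀ * ⟨h, hh⟩⁻¹ :
      ↥(unitaryGroupOfForm σ ((StdForm.antidiagonal 3).over K))) : GL (Fin 3) K) : Matrix (Fin 3) (Fin 3) K) =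
      1 + (t * t) • (((u₀ : GL (Fin 3) K) : Matrix (Fin 3) (Fin 3) K) - 1) := by
    simpa only [Subgroup.coe_mul, Subgroup.coe_inv] using hconj
  refine ⟨⟨h, hh⟩, ?_, mem_centralizer_iff_conj_mem_centralizer_of_coe_conj σ (mul_ne_zero ht ht) hconj'⟩
  rw [hconj', cayley_smul_inverseWindow_of_sub_one_mul_self_eq_zero h2 _ hsq]

end Unitary

/-! ## §3 The same in K2E3-p01's letters `hB` ∕ `hΨ` (`Ψ u₀ = h u₀ h⁻¹`) -/

section Model

variable {K : Type*} [NormedField K] [IsUltrametricDist K] (σ : K →+* K) (J : Matrix (Fin 3) (Fin 3) K) {ρ : ℝ} {s : K}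
  {B : Set ↥(unitaryGroupOfForm σ J)}
  (hB : ∀ u : ↥(unitaryGroupOfForm σ J), u ∈ B ↔
    IsUnit (((u : GL (Fin 3) K) : Matrix (Fin 3) (Fin 3) K) + 1).det ∧
    ‖((((u : GL (Fin 3) K) : Matrix (Fin 3) (Fin 3) K) - 1) * (((u : GL (Fin 3) K) : Matrix (Fin 3) (Fin 3) K) + 1)⁻¹).charpoly.coeff 2‖ ≤ ρ ∧
    ‖((((u : GL (Fin 3) K) : Matrix (Fin 3) (Fin 3) K) - 1) * (((u : GL (Fin 3) K) : Matrix (Fin 3) (Fin 3) K) + 1)⁻¹).charpoly.coeff 1‖ ≤ ρ ^ 2 ∧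
    ‖((((u : GL (Fin 3) K) : Matrix (Fin 3) (Fin 3) K) - 1) * (((u : GL (Fin 3) K) : Matrix (Fin 3) (Fin 3) K) + 1)⁻¹).charpoly.coeff 0‖ ≤ ρ ^ 3)
  {Ψ : ↥(unitaryGroupOfForm σ J) → ↥(unitaryGroupOfForm σ J)}
  (hΨ : ∀ u ∈ B,
    (((Ψ u : ↥(unitaryGroupOfForm σ J)) : GL (Fin 3) K) : Matrix (Fin 3) (Fin 3) K) =
        cayley (s • ((((u : GL (Fin 3) K) : Matrix (Fin 3) (Fin 3) K) - 1) * (((u : GL (Fin 3) K) : Matrix (Fin 3) (Fin 3) K) + 1)⁻¹)) ∧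
    ((((Ψ u : ↥(unitaryGroupOfForm σ J)) : GL (Fin 3) K)⁻¹ : GL (Fin 3) K) : Matrix (Fin 3) (Fin 3) K) =
        cayley (-(s • ((((u : GL (Fin 3) K) : Matrix (Fin 3) (Fin 3) K) - 1) * (((u : GL (Fin 3) K) : Matrix (Fin 3) (Fin 3) K) + 1)⁻¹))))

omit [IsUltrametricDist K] in
include hB hΨ in
/-- **(i) FOR THE TRANSVECTION CLASS in the letters `hΨ` ∕ `hZ` of ★ p855453 §1** (the antidiagonal model, `σ` an involution, `2 ≠ 0`, `0 ≤ ρ`, scalar `s = t·t` with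
`σ t = t ≠ 0`): for EVERY transvection `u₀` (`(mat u₀ − 1)² = 0`; it lies in `B` by ★ frame `mem_ball_of_isNilpotent`) there is `h ∈ U(σ, J₀)` with `Ψ u₀ = h u₀ h⁻¹` and
`∀ z, z ∈ Z(u₀) ↔ h z h⁻¹ ∈ Z(u₀)`. [cite: Rogawski1990, §3.9 p. 32; §8.1 Prop. 8.1.2 (b) p. 114] [cite: HarishChandra1999AdmissibleDistributions, §3.1 Lemma 3.2] -/
theorem exists_conj_normalizing_of_transvection (hJ : J = (StdForm.antidiagonal 3).over K) (hσ : ∀ z : K, σ (σ z) = z) (h2 : (2 : K) ≠ 0) (hρ : 0 ≤ ρ)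
    {t : K} (ht : t ≠ 0) (hσt : σ t = t) (hst : s = t * t) {u₀ : ↥(unitaryGroupOfForm σ J)}
    (hsq : (((u₀ : GL (Fin 3) K) : Matrix (Fin 3) (Fin 3) K) - 1) * (((u₀ : GL (Fin 3) K) : Matrix (Fin 3) (Fin 3) K) - 1) = 0) :
    ∃ h : ↥(unitaryGroupOfForm σ J), Ψ u₀ = h * u₀ * h⁻¹ ∧
      ∀ z : ↥(unitaryGroupOfForm σ J), z ∈ Subgroup.centralizer ({u₀} : Set ↥(unitaryGroupOfForm σ J)) ↔
        h * z * h⁻¹ ∈ Subgroup.centralizer ({u₀} : Set ↥(unitaryGroupOfForm σ J)) := by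
  obtain ⟨h, hmat, hZ⟩ := exists_conj_normalizing_of_sq_eq_zero σ hJ hσ h2 ht hσt (u₀ := u₀) hsq
  refine ⟨h, ?_, hZ⟩
  have hu₀ : u₀ ∈ B :=
    Summit.HodgeConjecture.HodgeConjecture.Cruxes.H413.K2E3UnipotentAdaptedFrame.mem_ball_of_isNilpotent σ J hB hρ h2 ⟨2, by rw [pow_two, hsq]⟩
  have hΨu := (hΨ u₀ hu₀).1
  rw [hst] at hΨu
  exact Subtype.ext (Units.ext (hΨu.trans hmat.symm))

end Model

end Summit.HodgeConjecture.HodgeConjecture.Cruxes.H413.K2E3UnipotentOrbitalScalingTransvection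

end
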